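import Summits.CriticalPhenomena.PercolationContinuityZ3.Theorems.Transplant.FKConnectivityAllQAntipodalAnd4Series
import HarnessLib

/-!
# Connectivity correlation inequalities for `φ_{w,q}`, every `q > 0` — file 31: `C_∞` at level 3 for the 3-STAR `S = K₁,₃ = {ao, ob, oc}` — the
# SERIES JUNCTION IDENTITY (root `ob`, `H \ ob = E₁(o,m) · E₂(m,b)`: AND-drift of the star = nonnegative combination of the SMALLER STAR `{ao, oc, om}`
# on side 1 (recursion through the virtual root edge `om`), the |W| = 3 AND of `{ao, oc}` on side 1, and Theorem U on side 2)

Support file (`--supports stmt-CriticalPhenomena-4575`), FK sub-lane `prim-bschramm-fk-2` (gen 19) of the post-continuity programme; builds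
on p205010 (kernel theorem, internal audit signed; external expert review pending).  No definitions, no named facts, no sorries; standard axioms.

THE PROBLEM (FK-Q2 §26–28).  The AND-drift of the star `S = {ao, ob, oc}` on a graph `N` against `g` is `a_S(g) = ∑_{γ ⊆ N} 𝔞(γ) g(γ)`,
`𝔞(γ) = q^{k(γ ∪ S) + k(N \ γ)} - q^{k((N \ γ) ∪ S) + k(γ)}`; Conjecture `C_∞` for the AND type `1_{S ⊆ ω}` is `a_S(g) ≤ 0` (`g` increasing,
`0 < q ≤ 1`).  Root the host `H ⊇ S` at `ob`: `K = H \ ob` is TTSP between `o` and `b` and contains `ao`, `oc`.  If the root of `K` is PARALLEL with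
`ao`, `oc` in different children, file 28b applies (star = path `a–o–b–c` for the AND functional); in one child, file 29's R-extension theorem
applies to the path `a–o–b–c` (junction pair `{o, b}`).  THIS FILE: the SERIES root `K = E₁(o,m) · E₂(m,b)` — then `ao, oc ∈ E₁` (`o` is off
`E₂`), `N = N₁ ⊔_m N₂` with `N₁ = E₁ \ {ao, oc}`, `N₂ = E₂`.  For `γ = γ₁ ⊔ γ₂` write `G₁ = k(γ₁)`, `Ḡ₁ = k(γ̄₁)`, `Y₁ = k(γ₁ ∪ {ao, oc})`,
`Z₁ = k(γ₁ ∪ {ao, om, oc})` (bars alike), `G₂, Ḡ₂`, `σ = 1{o ↔ m in γ₁ ∪ {ao, oc}}` (so `Y₁ = Z₁ + 1 - σ`), `τ = 1{m ↔ b in γ₂}`, `τ̄ = 1{m ↔ b in γ̄₂}`.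
Then (`and_star3_summand_series`)
`q^{2|V|+1} 𝔞(γ) = τ̄ q^{G₂+Ḡ₂} (q^{Z₁+1+Ḡ₁} - q^{Z̄₁+1+G₁}) + (1-τ̄) q^{G₂+Ḡ₂} (q^{Y₁+Ḡ₁} - q^{Ȳ₁+G₁}) + σ (q-1) q^{Y₁+Ḡ₁} · q^{G₂+Ḡ₂}(τ - τ̄)`
— `q^{Z₁+Ḡ₁} - q^{Z̄₁+G₁}` is the AND-summand of the SMALLER STAR `{ao, om, oc}` on `N₁` (the same problem for the host `E₁ ∪ {om}` rooted at its
virtual edge `om`: the recursion of file 31b), `q^{Y₁+Ḡ₁} - q^{Ȳ₁+G₁}` the |W| = 3 AND-summand of `{ao, oc}`, `q^{G₂+Ḡ₂}(τ - τ̄)` the Theorem-U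
summand of `E₂` (terminals `m, b`); all three multipliers have a fixed sign for `0 < q ≤ 1` and depend only on the other side (found by hand from
the four `(τ, τ̄)` cases after the path trichotomy; verified with free exponents and on configurations, explore/star_series.py; sixteen cases in
Lean).  Summing gives **`and_star3_series_nonpos`** (abstract: the three signed side functionals ⇒ `a_S(g) ≤ 0` on `N₁ ⊔ N₂`).
[cite: Grimmett2006, §1.4 eq. (1.20) (p. 15); §3.8 Thm. (3.90) (pp. 61–62); §3.9 (pp. 63–64)] [cite: Wagner2006, Thm. 5.8(d), §5.3]
-/

noncomputable section

namespace Summit.CriticalPhenomena.PercolationContinuityZ3.Theorems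

namespace FK

open SimpleGraph Literature.Probability.LatticeModels Literature.Probability.Percolation
open scoped Classical

variable {V : Type*} [Fintype V]

section StarSeries

variable {E₁ E₂ : Finset (Sym2 V)} {V₁ V₂ : Set V} {o a c m b : V}

omit [Fintype V] in
/-- The AND configuration of the star across a series junction: `(X ∪ Y) ∪ {ao, ob, oc} = ((X ∪ {ao, oc}) ∪ Y) ∪ {ob}`. [folklore] -/
theorem union_star3_series_eq (X Y : Finset (Sym2 V)) (o a c b : V) :
    X ∪ Y ∪ {s(a, o), s(o, b), s(o, c)} = insert s(o, b) (X ∪ {s(a, o), s(o, c)} ∪ Y) := by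
  ext e
  simp only [Finset.mem_union, Finset.mem_insert, Finset.mem_singleton]
  tauto

omit [Fintype V] in
/-- The smaller star: `X ∪ {ao, om, oc} = (X ∪ {ao, oc}) ∪ {om}`. [folklore] -/
theorem union_star3_eq_insert (X : Finset (Sym2 V)) (o a c m : V) :
    X ∪ {s(a, o), s(o, m), s(o, c)} = insert s(o, m) (X ∪ {s(a, o), s(o, c)}) := by
  ext e
  simp only [Finset.mem_union, Finset.mem_insert, Finset.mem_singleton]
  tauto

/-- **Star across a series junction, the `S`-side exponent.**  For `X ⊆ E₁ ∋ ao, oc` and `Y ⊆ E₂` (parts meeting only in `m`; `o` off `E₂`,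
`b` off `E₁`): `k(((X ∪ {ao,oc}) ∪ Y) ∪ {ob}) + |V| + 1 = k(X ∪ {ao,oc}) + k(Y) + 1{o ↔ m in X ∪ {ao,oc} and m ↔ b in Y}`.
[cite: Grimmett2006, §3.8 (pp. 61–62)] -/
theorem clusterCount_junction_star3_series (h₁ : ∀ e ∈ (↑E₁ : Set (Sym2 V)), ∀ z ∈ e, z ∈ V₁)
    (h₂ : ∀ e ∈ (↑E₂ : Set (Sym2 V)), ∀ z ∈ e, z ∈ V₂) (hS : V₁ ∩ V₂ ⊆ {m}) (hoV₂ : o ∉ V₂) (hbV₁ : b ∉ V₁)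
    (hom : o ≠ m) (hbm : b ≠ m) (hob : o ≠ b) (hao : s(a, o) ∈ E₁) (hoc : s(o, c) ∈ E₁)
    {X Y : Finset (Sym2 V)} (hX : X ⊆ E₁) (hY : Y ⊆ E₂) :
    clusterCount (↑(insert s(o, b) (X ∪ {s(a, o), s(o, c)} ∪ Y)) : BondConfig V) ∅ + Fintype.card V + 1 =
      clusterCount (↑(X ∪ {s(a, o), s(o, c)}) : BondConfig V) ∅ + clusterCount (↑Y : BondConfig V) ∅ +
        (if (openGraph (↑(X ∪ {s(a, o), s(o, c)}) : BondConfig V)).Reachable o m ∧ (openGraph (↑Y : BondConfig V)).Reachable m b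
          then 1 else 0) := by
  have hX' : X ∪ {s(a, o), s(o, c)} ⊆ E₁ := Finset.union_subset hX (by
    intro e he; simp only [Finset.mem_insert, Finset.mem_singleton] at he
    rcases he with rfl | rfl
    · exact hao
    · exact hoc)
  have kser := clusterCount_union_series h₁ h₂ hS hX' hY
  have kins := clusterCount_insert_add_ite (X ∪ {s(a, o), s(o, c)} ∪ Y) o b
  have hreach : (openGraph (↑(X ∪ {s(a, o), s(o, c)} ∪ Y) : BondConfig V)).Reachable o b ↔
      (openGraph (↑(X ∪ {s(a, o), s(o, c)}) : BondConfig V)).Reachable o m ∧ (openGraph (↑Y : BondConfig V)).Reachable m b := by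
    rw [Finset.coe_union]
    exact reachable_series_iff h₁ h₂ hS (Finset.coe_subset.2 hX') (Finset.coe_subset.2 hY) hoV₂ hbV₁ hom hbm hob
  by_cases hr : (openGraph (↑(X ∪ {s(a, o), s(o, c)}) : BondConfig V)).Reachable o m ∧ (openGraph (↑Y : BondConfig V)).Reachable m b
  · rw [if_pos (hreach.2 hr)] at kins; rw [if_pos hr]; omega
  · rw [if_neg (fun h => hr (hreach.1 h))] at kins; rw [if_neg hr]; omega

set_option linter.unusedSimpArgs false in
/-- **THE STAR–SERIES JUNCTION IDENTITY (pointwise).**  With `ω₁ = γ₁ ∪ {ao, oc}`, `Y₁ = k(ω₁)`, `Z₁ = k(ω₁ ∪ om)`, `G = k(γ)` (bars for the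
complements inside `N₁`, `N₂`), `σ = 1{o ↔ m in ω₁}`, `τ = 1{m ↔ b in γ₂}`, `τ̄ = 1{m ↔ b in γ̄₂}`:
`q^{2|V|+1} 𝔞(γ) = τ̄ q^{G₂+Ḡ₂}(q^{Z₁+1+Ḡ₁} - q^{Z̄₁+1+G₁}) + (1-τ̄) q^{G₂+Ḡ₂}(q^{Y₁+Ḡ₁} - q^{Ȳ₁+G₁}) + σ (q-1) q^{Y₁+Ḡ₁} · q^{G₂+Ḡ₂}(τ - τ̄)`
— sixteen cases in `σ, σ̄, τ, τ̄`. [cite: Grimmett2006, §3.8 (pp. 61–62)] -/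
theorem and_star3_summand_series (q : ℝ) (h₁ : ∀ e ∈ (↑E₁ : Set (Sym2 V)), ∀ z ∈ e, z ∈ V₁)
    (h₂ : ∀ e ∈ (↑E₂ : Set (Sym2 V)), ∀ z ∈ e, z ∈ V₂) (hS : V₁ ∩ V₂ ⊆ {m}) (hoV₂ : o ∉ V₂) (hbV₁ : b ∉ V₁)
    (hom : o ≠ m) (hbm : b ≠ m) (hob : o ≠ b) (hao : s(a, o) ∈ E₁) (hoc : s(o, c) ∈ E₁)
    {N₁ N₂ γ₁ γ₂ : Finset (Sym2 V)} (hN₁ : N₁ ⊆ E₁) (hN₂ : N₂ ⊆ E₂) (hγ₁ : γ₁ ⊆ N₁) (hγ₂ : γ₂ ⊆ N₂) (x : ℝ) :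
    q ^ (2 * Fintype.card V + 1) *
        ((q ^ (clusterCount (↑(insert s(o, b) (γ₁ ∪ {s(a, o), s(o, c)} ∪ γ₂)) : BondConfig V) ∅ +
              clusterCount (↑((N₁ \ γ₁) ∪ (N₂ \ γ₂)) : BondConfig V) ∅) -
          q ^ (clusterCount (↑(insert s(o, b) ((N₁ \ γ₁) ∪ {s(a, o), s(o, c)} ∪ (N₂ \ γ₂))) : BondConfig V) ∅ +
              clusterCount (↑(γ₁ ∪ γ₂) : BondConfig V) ∅)) * x) =
      (if (openGraph (↑(N₂ \ γ₂) : BondConfig V)).Reachable m b then 1 else 0) *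
          q ^ (clusterCount (↑γ₂ : BondConfig V) ∅ + clusterCount (↑(N₂ \ γ₂) : BondConfig V) ∅) *
          ((q ^ (clusterCount (↑(insert s(o, m) (γ₁ ∪ {s(a, o), s(o, c)})) : BondConfig V) ∅ + 1 + clusterCount (↑(N₁ \ γ₁) : BondConfig V) ∅) -
            q ^ (clusterCount (↑(insert s(o, m) ((N₁ \ γ₁) ∪ {s(a, o), s(o, c)})) : BondConfig V) ∅ + 1 + clusterCount (↑γ₁ : BondConfig V) ∅)) * x) +
      (if (openGraph (↑(N₂ \ γ₂) : BondConfig V)).Reachable m b then 0 else 1) *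
          q ^ (clusterCount (↑γ₂ : BondConfig V) ∅ + clusterCount (↑(N₂ \ γ₂) : BondConfig V) ∅) *
          ((q ^ (clusterCount (↑(γ₁ ∪ {s(a, o), s(o, c)}) : BondConfig V) ∅ + clusterCount (↑(N₁ \ γ₁) : BondConfig V) ∅) -
            q ^ (clusterCount (↑((N₁ \ γ₁) ∪ {s(a, o), s(o, c)}) : BondConfig V) ∅ + clusterCount (↑γ₁ : BondConfig V) ∅)) * x) +
      (if (openGraph (↑(γ₁ ∪ {s(a, o), s(o, c)}) : BondConfig V)).Reachable o m then 1 else 0) * (q - 1) *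
          q ^ (clusterCount (↑(γ₁ ∪ {s(a, o), s(o, c)}) : BondConfig V) ∅ + clusterCount (↑(N₁ \ γ₁) : BondConfig V) ∅) *
          (q ^ apExp N₂ γ₂ * ((apConn γ₂ m b - apConn (N₂ \ γ₂) m b) * x)) := by
  -- junction bookkeeping for the four exponents of the left-hand side
  have eS := clusterCount_junction_star3_series h₁ h₂ hS hoV₂ hbV₁ hom hbm hob hao hoc (hγ₁.trans hN₁) (hγ₂.trans hN₂)
  have eSb := clusterCount_junction_star3_series h₁ h₂ hS hoV₂ hbV₁ hom hbm hob hao hoc (Finset.sdiff_subset.trans hN₁)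
    (Finset.sdiff_subset.trans hN₂) (X := N₁ \ γ₁) (Y := N₂ \ γ₂)
  have eC := clusterCount_union_series h₁ h₂ hS (Finset.sdiff_subset.trans hN₁) (Finset.sdiff_subset.trans hN₂)
    (X := N₁ \ γ₁) (Y := N₂ \ γ₂)
  have eG := clusterCount_union_series h₁ h₂ hS (hγ₁.trans hN₁) (hγ₂.trans hN₂) (X := γ₁) (Y := γ₂)
  -- the virtual root edge `om` of side 1
  have z₁ := clusterCount_insert_add_ite (γ₁ ∪ {s(a, o), s(o, c)}) o m
  have zb₁ := clusterCount_insert_add_ite ((N₁ \ γ₁) ∪ {s(a, o), s(o, c)}) o m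
  unfold apExp apConn
  -- abbreviate the atoms
  set KS := clusterCount (↑(insert s(o, b) (γ₁ ∪ {s(a, o), s(o, c)} ∪ γ₂)) : BondConfig V) ∅
  set KSb := clusterCount (↑(insert s(o, b) ((N₁ \ γ₁) ∪ {s(a, o), s(o, c)} ∪ (N₂ \ γ₂))) : BondConfig V) ∅
  set KC := clusterCount (↑((N₁ \ γ₁) ∪ (N₂ \ γ₂)) : BondConfig V) ∅
  set KG := clusterCount (↑(γ₁ ∪ γ₂) : BondConfig V) ∅
  set Y₁ := clusterCount (↑(γ₁ ∪ {s(a, o), s(o, c)}) : BondConfig V) ∅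
  set Yb₁ := clusterCount (↑((N₁ \ γ₁) ∪ {s(a, o), s(o, c)}) : BondConfig V) ∅
  set Z₁ := clusterCount (↑(insert s(o, m) (γ₁ ∪ {s(a, o), s(o, c)})) : BondConfig V) ∅
  set Zb₁ := clusterCount (↑(insert s(o, m) ((N₁ \ γ₁) ∪ {s(a, o), s(o, c)})) : BondConfig V) ∅
  set G₁ := clusterCount (↑γ₁ : BondConfig V) ∅
  set Gb₁ := clusterCount (↑(N₁ \ γ₁) : BondConfig V) ∅
  set G₂ := clusterCount (↑γ₂ : BondConfig V) ∅
  set Gb₂ := clusterCount (↑(N₂ \ γ₂) : BondConfig V) ∅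
  -- the left-hand side as one power
  have lhs1 : q ^ (2 * Fintype.card V + 1) * q ^ (KS + KC) = q ^ (KS + Fintype.card V + 1 + (KC + Fintype.card V)) := by
    rw [← pow_add]; congr 1; omega
  have lhs2 : q ^ (2 * Fintype.card V + 1) * q ^ (KSb + KG) = q ^ (KSb + Fintype.card V + 1 + (KG + Fintype.card V)) := by
    rw [← pow_add]; congr 1; omega
  have expand : q ^ (2 * Fintype.card V + 1) * ((q ^ (KS + KC) - q ^ (KSb + KG)) * x) =
      (q ^ (KS + Fintype.card V + 1 + (KC + Fintype.card V)) - q ^ (KSb + Fintype.card V + 1 + (KG + Fintype.card V))) * x := by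
    rw [← lhs1, ← lhs2]; ring
  rw [expand, eS, eSb, eC, eG]
  by_cases s₁ : (openGraph (↑(γ₁ ∪ {s(a, o), s(o, c)}) : BondConfig V)).Reachable o m <;>
  by_cases sb₁ : (openGraph (↑((N₁ \ γ₁) ∪ {s(a, o), s(o, c)}) : BondConfig V)).Reachable o m <;>
  by_cases t₂ : (openGraph (↑γ₂ : BondConfig V)).Reachable m b <;>
  by_cases tb₂ : (openGraph (↑(N₂ \ γ₂) : BondConfig V)).Reachable m b <;>
  simp only [s₁, sb₁, t₂, tb₂, and_self, and_true, true_and, and_false, false_and, if_true, if_false,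
    not_false_eq_true, not_true_eq_false, add_zero] at z₁ zb₁ ⊢ <;>
  (rw [← z₁, ← zb₁]; ring)

/-- **THE STAR–SERIES JUNCTION IDENTITY (summed).**  For `N = N₁ ⊔_m N₂` (side 1 `⊆ E₁ ∋ ao, oc`, side 2 `⊆ E₂`) and `S = {ao, ob, oc}`:
`q^{2|V|+1} · ∑_{γ ⊆ N} 𝔞(γ) g(γ)` is the sum over `γ₂ ⊆ N₂` of nonnegative multiples of the side-1 functionals of the smaller star `{ao, om, oc}`
and of the pair `{ao, oc}` (on the sections `g(· ∪ γ₂)`), plus the sum over `γ₁ ⊆ N₁` of nonpositive (`q ≤ 1`) multiples of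
`apUpc q N₂ m b (g(γ₁ ∪ ·))`. [cite: Grimmett2006, §3.8 Thm. (3.90) (pp. 61–62)] -/
theorem and_star3_series_eq (q : ℝ) (h₁ : ∀ e ∈ (↑E₁ : Set (Sym2 V)), ∀ z ∈ e, z ∈ V₁)
    (h₂ : ∀ e ∈ (↑E₂ : Set (Sym2 V)), ∀ z ∈ e, z ∈ V₂) (hS : V₁ ∩ V₂ ⊆ {m}) (hoV₂ : o ∉ V₂) (hbV₁ : b ∉ V₁)
    (hom : o ≠ m) (hbm : b ≠ m) (hob : o ≠ b) (hao : s(a, o) ∈ E₁) (hoc : s(o, c) ∈ E₁)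
    {N₁ N₂ : Finset (Sym2 V)} (hd : Disjoint N₁ N₂) (hN₁ : N₁ ⊆ E₁) (hN₂ : N₂ ⊆ E₂) (g : Finset (Sym2 V) → ℝ) :
    q ^ (2 * Fintype.card V + 1) *
        ∑ γ ∈ (N₁ ∪ N₂).powerset,
          (q ^ (clusterCount (↑(γ ∪ {s(a, o), s(o, b), s(o, c)}) : BondConfig V) ∅ + clusterCount (↑((N₁ ∪ N₂) \ γ) : BondConfig V) ∅) -
              q ^ (clusterCount (↑((N₁ ∪ N₂) \ γ ∪ {s(a, o), s(o, b), s(o, c)}) : BondConfig V) ∅ + clusterCount (↑γ : BondConfig V) ∅)) * g γ =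
      ∑ γ₂ ∈ N₂.powerset,
          ((if (openGraph (↑(N₂ \ γ₂) : BondConfig V)).Reachable m b then 1 else 0) *
              q ^ (clusterCount (↑γ₂ : BondConfig V) ∅ + clusterCount (↑(N₂ \ γ₂) : BondConfig V) ∅) *
              ∑ γ₁ ∈ N₁.powerset, (q ^ (clusterCount (↑(insert s(o, m) (γ₁ ∪ {s(a, o), s(o, c)})) : BondConfig V) ∅ + 1 +
                  clusterCount (↑(N₁ \ γ₁) : BondConfig V) ∅) -
                q ^ (clusterCount (↑(insert s(o, m) ((N₁ \ γ₁) ∪ {s(a, o), s(o, c)})) : BondConfig V) ∅ + 1 +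
                  clusterCount (↑γ₁ : BondConfig V) ∅)) * g (γ₁ ∪ γ₂) +
            (if (openGraph (↑(N₂ \ γ₂) : BondConfig V)).Reachable m b then 0 else 1) *
              q ^ (clusterCount (↑γ₂ : BondConfig V) ∅ + clusterCount (↑(N₂ \ γ₂) : BondConfig V) ∅) *
              ∑ γ₁ ∈ N₁.powerset, (q ^ (clusterCount (↑(γ₁ ∪ {s(a, o), s(o, c)}) : BondConfig V) ∅ + clusterCount (↑(N₁ \ γ₁) : BondConfig V) ∅) -
                q ^ (clusterCount (↑((N₁ \ γ₁) ∪ {s(a, o), s(o, c)}) : BondConfig V) ∅ + clusterCount (↑γ₁ : BondConfig V) ∅)) * g (γ₁ ∪ γ₂)) +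
        ∑ γ₁ ∈ N₁.powerset,
          (if (openGraph (↑(γ₁ ∪ {s(a, o), s(o, c)}) : BondConfig V)).Reachable o m then 1 else 0) * (q - 1) *
            q ^ (clusterCount (↑(γ₁ ∪ {s(a, o), s(o, c)}) : BondConfig V) ∅ + clusterCount (↑(N₁ \ γ₁) : BondConfig V) ∅) *
            apUpc q N₂ m b (fun γ₂ => g (γ₁ ∪ γ₂)) := by
  unfold apUpc
  rw [Finset.mul_sum, sum_powerset_union_disj hd]
  simp_rw [Finset.mul_sum, ← Finset.sum_add_distrib]
  rw [Finset.sum_comm (s := N₂.powerset) (t := N₁.powerset), ← Finset.sum_add_distrib]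
  refine Finset.sum_congr rfl fun γ₁ hγ₁ => ?_
  rw [← Finset.sum_add_distrib]
  refine Finset.sum_congr rfl fun γ₂ hγ₂ => ?_
  rw [Finset.mem_powerset] at hγ₁ hγ₂
  rw [union_sdiff_union hd hγ₁ hγ₂, union_star3_series_eq, union_star3_series_eq,
    and_star3_summand_series q h₁ h₂ hS hoV₂ hbV₁ hom hbm hob hao hoc hN₁ hN₂ hγ₁ hγ₂ (g (γ₁ ∪ γ₂))]

/-- **AND for a 3-star across a series junction (abstract form).**  If on side 1 the AND-drift of the SMALLER STAR `{ao, om, oc}` (virtual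
root edge `om`) and the |W| = 3 AND-drift of `{ao, oc}` are `≤ 0` on every monotone test function, and on side 2 the Theorem-U functional
with terminals `m, b` is `≥ 0` on every monotone test function, then the AND-drift of `S = {ao, ob, oc}` on `N = N₁ ⊔_m N₂` is `≤ 0` on
every monotone `g` (`0 < q ≤ 1`). [cite: Grimmett2006, §3.8 Thm. (3.90) (pp. 61–62)] -/
theorem and_star3_series_nonpos {q : ℝ} (hq0 : 0 < q) (hq1 : q ≤ 1) (h₁ : ∀ e ∈ (↑E₁ : Set (Sym2 V)), ∀ z ∈ e, z ∈ V₁)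
    (h₂ : ∀ e ∈ (↑E₂ : Set (Sym2 V)), ∀ z ∈ e, z ∈ V₂) (hS : V₁ ∩ V₂ ⊆ {m}) (hoV₂ : o ∉ V₂) (hbV₁ : b ∉ V₁)
    (hom : o ≠ m) (hbm : b ≠ m) (hob : o ≠ b) (hao : s(a, o) ∈ E₁) (hoc : s(o, c) ∈ E₁)
    {N₁ N₂ : Finset (Sym2 V)} (hd : Disjoint N₁ N₂) (hN₁ : N₁ ⊆ E₁) (hN₂ : N₂ ⊆ E₂)
    (hZ₁ : ∀ h' : Finset (Sym2 V) → ℝ, (∀ ⦃A B : Finset (Sym2 V)⦄, A ⊆ B → B ⊆ N₁ → h' A ≤ h' B) →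
      ∑ γ₁ ∈ N₁.powerset, (q ^ (clusterCount (↑(γ₁ ∪ {s(a, o), s(o, m), s(o, c)}) : BondConfig V) ∅ + clusterCount (↑(N₁ \ γ₁) : BondConfig V) ∅) -
        q ^ (clusterCount (↑((N₁ \ γ₁) ∪ {s(a, o), s(o, m), s(o, c)}) : BondConfig V) ∅ + clusterCount (↑γ₁ : BondConfig V) ∅)) * h' γ₁ ≤ 0)
    (hY₁ : ∀ h' : Finset (Sym2 V) → ℝ, (∀ ⦃A B : Finset (Sym2 V)⦄, A ⊆ B → B ⊆ N₁ → h' A ≤ h' B) →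
      ∑ γ₁ ∈ N₁.powerset, (q ^ (clusterCount (↑(γ₁ ∪ {s(a, o), s(o, c)}) : BondConfig V) ∅ + clusterCount (↑(N₁ \ γ₁) : BondConfig V) ∅) -
        q ^ (clusterCount (↑((N₁ \ γ₁) ∪ {s(a, o), s(o, c)}) : BondConfig V) ∅ + clusterCount (↑γ₁ : BondConfig V) ∅)) * h' γ₁ ≤ 0)
    (hU₂ : ∀ h' : Finset (Sym2 V) → ℝ, (∀ ⦃A B : Finset (Sym2 V)⦄, A ⊆ B → B ⊆ N₂ → h' A ≤ h' B) → 0 ≤ apUpc q N₂ m b h')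
    {g : Finset (Sym2 V) → ℝ} (hmono : ∀ ⦃A B : Finset (Sym2 V)⦄, A ⊆ B → B ⊆ N₁ ∪ N₂ → g A ≤ g B) :
    ∑ γ ∈ (N₁ ∪ N₂).powerset,
        (q ^ (clusterCount (↑(γ ∪ {s(a, o), s(o, b), s(o, c)}) : BondConfig V) ∅ + clusterCount (↑((N₁ ∪ N₂) \ γ) : BondConfig V) ∅) -
            q ^ (clusterCount (↑((N₁ ∪ N₂) \ γ ∪ {s(a, o), s(o, b), s(o, c)}) : BondConfig V) ∅ + clusterCount (↑γ : BondConfig V) ∅)) * g γ ≤ 0 := by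
  have hpos : 0 < q ^ (2 * Fintype.card V + 1) := pow_pos hq0 _
  have key := and_star3_series_eq q h₁ h₂ hS hoV₂ hbV₁ hom hbm hob hao hoc hd hN₁ hN₂ g
  suffices hle : q ^ (2 * Fintype.card V + 1) *
      ∑ γ ∈ (N₁ ∪ N₂).powerset,
        (q ^ (clusterCount (↑(γ ∪ {s(a, o), s(o, b), s(o, c)}) : BondConfig V) ∅ + clusterCount (↑((N₁ ∪ N₂) \ γ) : BondConfig V) ∅) -
            q ^ (clusterCount (↑((N₁ ∪ N₂) \ γ ∪ {s(a, o), s(o, b), s(o, c)}) : BondConfig V) ∅ + clusterCount (↑γ : BondConfig V) ∅)) * g γ ≤ 0 by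
    by_contra hcon
    exact absurd hle (not_le.2 (mul_pos hpos (not_le.1 hcon)))
  rw [key]
  have hq1' : q - 1 ≤ 0 := by linarith
  have sec₁ : ∀ γ₂ ∈ N₂.powerset, ∀ ⦃A B : Finset (Sym2 V)⦄, A ⊆ B → B ⊆ N₁ → g (A ∪ γ₂) ≤ g (B ∪ γ₂) := by
    intro γ₂ hγ₂ A B hAB hB
    rw [Finset.mem_powerset] at hγ₂
    exact hmono (Finset.union_subset_union hAB le_rfl) (Finset.union_subset_union hB hγ₂)
  have sec₂ : ∀ γ₁ ∈ N₁.powerset, ∀ ⦃A B : Finset (Sym2 V)⦄, A ⊆ B → B ⊆ N₂ → g (γ₁ ∪ A) ≤ g (γ₁ ∪ B) := by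
    intro γ₁ hγ₁ A B hAB hB
    rw [Finset.mem_powerset] at hγ₁
    exact hmono (Finset.union_subset_union le_rfl hAB) (Finset.union_subset_union hγ₁ hB)
  -- the smaller-star functional, with the shift `+1` in both exponents pulled out as a factor `q`
  have hZ₁' : ∀ γ₂ ∈ N₂.powerset,
      ∑ γ₁ ∈ N₁.powerset, (q ^ (clusterCount (↑(insert s(o, m) (γ₁ ∪ {s(a, o), s(o, c)})) : BondConfig V) ∅ + 1 +
          clusterCount (↑(N₁ \ γ₁) : BondConfig V) ∅) -
        q ^ (clusterCount (↑(insert s(o, m) ((N₁ \ γ₁) ∪ {s(a, o), s(o, c)})) : BondConfig V) ∅ + 1 +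
          clusterCount (↑γ₁ : BondConfig V) ∅)) * g (γ₁ ∪ γ₂) ≤ 0 := by
    intro γ₂ hγ₂
    have i := hZ₁ (fun γ₁ => g (γ₁ ∪ γ₂)) (sec₁ γ₂ hγ₂)
    have hsum : ∑ γ₁ ∈ N₁.powerset, (q ^ (clusterCount (↑(insert s(o, m) (γ₁ ∪ {s(a, o), s(o, c)})) : BondConfig V) ∅ + 1 +
          clusterCount (↑(N₁ \ γ₁) : BondConfig V) ∅) -
        q ^ (clusterCount (↑(insert s(o, m) ((N₁ \ γ₁) ∪ {s(a, o), s(o, c)})) : BondConfig V) ∅ + 1 +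
          clusterCount (↑γ₁ : BondConfig V) ∅)) * g (γ₁ ∪ γ₂) =
        q * ∑ γ₁ ∈ N₁.powerset, (q ^ (clusterCount (↑(γ₁ ∪ {s(a, o), s(o, m), s(o, c)}) : BondConfig V) ∅ +
          clusterCount (↑(N₁ \ γ₁) : BondConfig V) ∅) -
        q ^ (clusterCount (↑((N₁ \ γ₁) ∪ {s(a, o), s(o, m), s(o, c)}) : BondConfig V) ∅ + clusterCount (↑γ₁ : BondConfig V) ∅)) *
          g (γ₁ ∪ γ₂) := by
      rw [Finset.mul_sum]
      refine Finset.sum_congr rfl fun γ₁ _ => ?_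
      rw [← union_star3_eq_insert, ← union_star3_eq_insert]
      ring
    rw [hsum]
    exact mul_nonpos_of_nonneg_of_nonpos hq0.le i
  refine add_nonpos (Finset.sum_nonpos fun γ₂ hγ₂ => ?_) (Finset.sum_nonpos fun γ₁ hγ₁ => ?_)
  · have i₁ := hZ₁' γ₂ hγ₂
    have i₂ := hY₁ (fun γ₁ => g (γ₁ ∪ γ₂)) (sec₁ γ₂ hγ₂)
    refine add_nonpos (mul_nonpos_of_nonneg_of_nonpos (mul_nonneg ?_ (pow_nonneg hq0.le _)) i₁)
      (mul_nonpos_of_nonneg_of_nonpos (mul_nonneg ?_ (pow_nonneg hq0.le _)) i₂) <;>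
    split_ifs <;> norm_num
  · have i₃ := hU₂ (fun γ₂ => g (γ₁ ∪ γ₂)) (sec₂ γ₁ hγ₁)
    have hc : (0 : ℝ) ≤ (if (openGraph (↑(γ₁ ∪ {s(a, o), s(o, c)}) : BondConfig V)).Reachable o m then 1 else 0) := by
      split_ifs <;> norm_num
    have : (if (openGraph (↑(γ₁ ∪ {s(a, o), s(o, c)}) : BondConfig V)).Reachable o m then (1 : ℝ) else 0) * (q - 1) *
        q ^ (clusterCount (↑(γ₁ ∪ {s(a, o), s(o, c)}) : BondConfig V) ∅ + clusterCount (↑(N₁ \ γ₁) : BondConfig V) ∅) ≤ 0 :=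
      mul_nonpos_of_nonpos_of_nonneg (mul_nonpos_of_nonneg_of_nonpos hc hq1') (pow_nonneg hq0.le _)
    exact mul_nonpos_of_nonpos_of_nonneg this i₃

end StarSeries

end FK

end Summit.CriticalPhenomena.PercolationContinuityZ3.Theorems

end
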